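import Summits.KontsevichZagierPeriods.KontsevichZagierPeriods.Theses.SymplecticScissors
import Literature.NumberTheory.Transcendental.SemialgebraicAlgebraicPoints
import Literature.NumberTheory.Transcendental.KZSemiCanonicalReductionProofs
import Literature.NumberTheory.Transcendental.LindemannWeierstrassProofs

/-!
# `CubeNashNormalForm` (stmt-KontsevichZagierPeriods-3574) — negative knowledge I: two refuted
# strengthenings of the cube–Nash normal form (no cube terms; cube dimensions budgeted to `0`)

Landed copy of §4 of the standing disprover's work file `Cruxes/CubeNashNormalForm/Disproof.lean`
(refuter `cdisprove`, cycle 1). The crux (routes SymplecticScissors / DimensionBudget / LiftingCriteria,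
verbatim) says: every difference `[r] − [r']` of KZ-rational representations is, modulo `KZ.relations`,
a `ℤ`-combination `∑ εᵢ [sᵢ]` of cube–Nash representations (`(sᵢ).domain = [0,1]^{nᵢ}`, integrand a
`ℚ`-semialgebraic function real-analytic near the closed cube). Two lemmas, each the crux VERBATIM with
one constant mutated (inlined, no new `Prop`, no definition), sorry-free, axioms ⊆ {propext,
Classical.choice, Quot.sound}:

* `not_cubeNashNormalForm_noCubes` — the number of cube terms cannot be forced to `S = 0`: relations
  evaluate to `0` (soundness, `KZ.relations_le_ker_eval_holds`) while `[r] − [r.neg]` evaluates to `2π`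
  for the witness `r = ∫_ℝ dx/(1+x²)` (`exists_isRational_value_pi`, dimension `1`, KZ-rational).
* `not_cubeNashNormalForm_dimZeroCubes` — the cube DIMENSIONS cannot be budgeted to `nᵢ = 0`: a
  dimension-`0` cube–Nash representation is an algebraic constant
  (`isAlgebraic_value_of_dim_zero_cube`, from `IsSemialgebraicFunOn.isAlgebraic_apply`), so the same
  witness would make `2π` algebraic, contradicting Lindemann (`transcendental_pi_holds`). Hence for the
  dimension-`1` representation `∫_ℝ dx/(1+x²)` cubes of dimension `≥ 1` are necessary: the natural
  (unclaimed, open) budget `nᵢ ≤ max k k'` would be SHARP at `k = 1`.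

Positive companions (NOT here): dimensions `k, k' ≤ 1` of the crux are theorems
(`LiftingCriteria.CubeNashNormalFormDimLeOne.cubeNashNormalForm_dim_le_one`); the crux is implied by
the summit plus the printed value-level normal form (work file, `cubeNashNormalForm_of_summit`).
[cite: KontsevichZagier2001, §1.2] [cite: Baker1975, Thm 1.2 (Lindemann)]
-/

noncomputable section

open MeasureTheory Set MvPolynomial
open Literature.NumberTheory.Transcendental Literature.NumberTheory.Transcendental.KZ
open Literature.ModelTheory.ExponentialFields (IsSemialgebraic isSemialgebraic_univ)

namespace Summit.KontsevichZagierPeriods.CubeNashNormalFormNegative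

/-! ### The witness `∫_ℝ dx/(1+x²) = π` (dimension `1`, KZ-rational) -/

/-- The denominator `1 + x₀²` does not vanish. [folklore] -/
theorem lorentz_denom_ne_zero :
    ∀ x ∈ (Set.univ : Set (Fin 1 → ℝ)), aeval x ((1 : MvPolynomial (Fin 1) ℚ) + X 0 ^ 2) ≠ 0 := by
  intro x _
  simp only [map_add, map_one, map_pow, aeval_X]
  positivity

/-- The integrand `1/(1+x₀²)` on `ℝ¹` is `(1+y²)⁻¹` transported along `ℝ¹ ≃ ℝ`. [folklore] -/
theorem lorentz_fun_eq :
    (fun x : Fin 1 → ℝ => aeval x (1 : MvPolynomial (Fin 1) ℚ) /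
        aeval x ((1 : MvPolynomial (Fin 1) ℚ) + X 0 ^ 2)) =
      (fun y : ℝ => (1 + y ^ 2)⁻¹) ∘ (MeasurableEquiv.funUnique (Fin 1) ℝ) := by
  funext x
  simp [MeasurableEquiv.funUnique, one_div]

/-- `1/(1+x₀²)` is absolutely integrable on `ℝ¹` (`integrable_inv_one_add_sq`, transported). [folklore] -/
theorem lorentz_integrableOn :
    IntegrableOn (fun x : Fin 1 → ℝ => aeval x (1 : MvPolynomial (Fin 1) ℚ) /
        aeval x ((1 : MvPolynomial (Fin 1) ℚ) + X 0 ^ 2)) Set.univ := by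
  rw [integrableOn_univ, lorentz_fun_eq]
  exact ((volume_preserving_funUnique (Fin 1) ℝ).integrable_comp_emb
    (MeasurableEquiv.measurableEmbedding _)).2 integrable_inv_one_add_sq

/-- **The witness**: a KZ-rational representation of dimension `1` with value `π`, namely
`∫_{ℝ} dx/(1+x²)` (domain `ℝ¹`, `p = 1`, `q = 1 + X₀²`; value by `integral_univ_inv_one_add_sq`
transported along `ℝ¹ ≃ ℝ`). [Kontsevich–Zagier 2001, §1.1] -/
theorem exists_isRational_value_pi : ∃ r : IntegralRep 1, r.IsRational ∧ r.value = Real.pi := by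
  refine ⟨IntegralRep.ofRational (Set.univ : Set (Fin 1 → ℝ)) (1 : MvPolynomial (Fin 1) ℚ)
      (1 + X 0 ^ 2) isSemialgebraic_univ lorentz_denom_ne_zero lorentz_integrableOn,
    IntegralRep.isRational_ofRational _ _ _ _ _ _, ?_⟩
  rw [IntegralRep.value_ofRational, Measure.restrict_univ, lorentz_fun_eq]
  have h := (volume_preserving_funUnique (Fin 1) ℝ).integral_comp'
    (f := MeasurableEquiv.funUnique (Fin 1) ℝ) (fun y : ℝ => (1 + y ^ 2)⁻¹)
  simp only [Function.comp_def]
  exact h.trans integral_univ_inv_one_add_sq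

/-! ### Strengthening (a): the cube terms cannot be dropped -/

/-- **STRENGTHENING (a) REFUTED — the cube terms cannot be dropped**: it is false that every
difference of KZ-rational representations is already a relation (`S = 0` in the crux): for the witness
`r = ∫_ℝ dx/(1+x²)`, `[r] − [r.neg]` evaluates to `2π ≠ 0`, relations evaluate to `0`. [folklore] -/
theorem not_cubeNashNormalForm_noCubes :
    ¬ ∀ (k k' : ℕ) (r : IntegralRep k) (r' : IntegralRep k'), r.IsRational → r'.IsRational →
        of r - of r' ∈ relations := by
  intro h
  obtain ⟨r, hr, hv⟩ := exists_isRational_value_pi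
  have hmem := h 1 1 r r.neg hr hr.neg
  have h0 := relations_le_ker_eval_holds hmem
  rw [AddMonoidHom.mem_ker, map_sub, eval_of, eval_of, IntegralRep.value_neg, hv] at h0
  linarith [Real.pi_pos]

/-! ### Strengthening (b): the cube dimensions cannot be budgeted to `0` -/

/-- The value of a dimension-`0` cube–Nash representation is the value of its Nash function at the
point `[0,1]⁰ = pt`. [folklore] -/
theorem value_eq_of_dim_zero_cube (t : IntegralRep 0) (g : (Fin 0 → ℝ) → ℝ)
    (hd : t.domain = Set.pi Set.univ (fun _ : Fin 0 => Set.Icc (0:ℝ) 1))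
    (hi : ∀ z ∈ Set.pi Set.univ (fun _ : Fin 0 => Set.Icc (0:ℝ) 1), t.integrand z = g z) :
    t.value = g (fun i => i.elim0) := by
  have hcube : Set.pi Set.univ (fun _ : Fin 0 => Set.Icc (0:ℝ) 1) = univ :=
    eq_univ_of_forall fun x => Set.mem_univ_pi.mpr fun i => i.elim0
  rw [IntegralRep.value, hd, hcube, Measure.restrict_univ, MeasureTheory.volume_pi,
    Measure.pi_of_empty (fun _ : Fin 0 => (volume : Measure ℝ)) (fun i => i.elim0), integral_dirac]
  exact hi _ (hcube ▸ mem_univ _)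

/-- **A dimension-`0` cube–Nash value is algebraic**: it is the value of a `ℚ`-semialgebraic function
at the (algebraic) point of `ℝ⁰` (`IsSemialgebraicFunOn.isAlgebraic_apply`). [folklore] -/
theorem isAlgebraic_value_of_dim_zero_cube (t : IntegralRep 0) (g : (Fin 0 → ℝ) → ℝ)
    (U : Set (Fin 0 → ℝ)) (hU : Set.pi Set.univ (fun _ : Fin 0 => Set.Icc (0:ℝ) 1) ⊆ U)
    (hg : IsSemialgebraicFunOn ℚ U g)
    (hd : t.domain = Set.pi Set.univ (fun _ : Fin 0 => Set.Icc (0:ℝ) 1))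
    (hi : ∀ z ∈ Set.pi Set.univ (fun _ : Fin 0 => Set.Icc (0:ℝ) 1), t.integrand z = g z) :
    IsAlgebraic ℚ t.value := by
  rw [value_eq_of_dim_zero_cube t g hd hi]
  exact hg.isAlgebraic_apply (hU (Set.mem_univ_pi.mpr fun i => i.elim0)) fun i => i.elim0

/-- Evaluation of a `ℤ`-combination of generators. [folklore] -/
theorem eval_sum_zsmul_of {S : ℕ} {n : Fin S → ℕ} (ε : Fin S → ℤ)
    (s : (i : Fin S) → IntegralRep (n i)) :
    eval (∑ i, ε i • of (s i)) = ∑ i, (ε i : ℝ) * (s i).value := by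
  simp [map_sum, map_zsmul, eval_of, zsmul_eq_mul]

/-- **STRENGTHENING (b) REFUTED — the cube dimensions cannot be budgeted to `0`.** The crux with all
`n i = 0` (normal form by ALGEBRAIC CONSTANTS, which is what a `0`-dimensional cube–Nash generator is)
fails: for the witness `r = ∫_ℝ dx/(1+x²)`, `[r] − [r.neg]` would evaluate to an algebraic number, but it
evaluates to `2π`
(Lindemann, tree theorem `transcendental_pi_holds`). For this dimension-`1` representation
cubes of dimension `≥ 1` are therefore necessary; the natural budget `n i ≤ max k k'` (not claimed by the
item, open) would be sharp at `k = 1`. [Lindemann 1882; folklore] -/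
theorem not_cubeNashNormalForm_dimZeroCubes :
    ¬ ∀ (k k' : ℕ) (r : IntegralRep k) (r' : IntegralRep k'), r.IsRational → r'.IsRational →
        ∃ (S : ℕ) (g : Fin S → (Fin 0 → ℝ) → ℝ) (U : Fin S → Set (Fin 0 → ℝ)) (ε : Fin S → ℤ)
          (s : Fin S → IntegralRep 0),
          (∀ i, IsOpen (U i) ∧ Set.pi Set.univ (fun _ : Fin 0 => Set.Icc (0:ℝ) 1) ⊆ (U i) ∧
            IsSemialgebraicFunOn ℚ (U i) (g i) ∧ AnalyticOnNhd ℝ (g i) (U i)) ∧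
          (∀ i, (s i).domain = Set.pi Set.univ (fun _ : Fin 0 => Set.Icc (0:ℝ) 1) ∧
            ∀ z ∈ Set.pi Set.univ (fun _ : Fin 0 => Set.Icc (0:ℝ) 1), (s i).integrand z = g i z) ∧
          of r - of r' - ∑ i, ε i • of (s i) ∈ relations := by
  intro h
  obtain ⟨r, hr, hv⟩ := exists_isRational_value_pi
  obtain ⟨S, g, U, ε, s, hg, hs, hmem⟩ := h 1 1 r r.neg hr hr.neg
  have h0 := relations_le_ker_eval_holds hmem
  rw [AddMonoidHom.mem_ker, map_sub, map_sub, eval_of, eval_of, IntegralRep.value_neg, hv,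
    eval_sum_zsmul_of (n := fun _ => 0), sub_eq_zero] at h0
  -- every summand is algebraic, hence so is `π − (−π) = 2π`, hence `π`
  set A : Subalgebra ℚ ℝ := integralClosure ℚ ℝ with hA
  have hval : ∀ i, (s i).value ∈ A := fun i =>
    (mem_integralClosure_iff ℚ ℝ).2 (isAlgebraic_value_of_dim_zero_cube (s i) (g i) (U i) (hg i).2.1
      (hg i).2.2.1 (hs i).1 (hs i).2).isIntegral
  have hsum : ∑ i, (ε i : ℝ) * (s i).value ∈ A :=
    Subalgebra.sum_mem _ fun i _ => Subalgebra.mul_mem _ (intCast_mem A (ε i)) (hval i)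
  rw [← h0] at hsum
  have hpi : Real.pi ∈ A := by
    have := Subalgebra.smul_mem A hsum (1 / 2 : ℚ)
    rw [Rat.smul_def] at this
    convert this using 1
    push_cast
    ring
  exact transcendental_pi_holds ((mem_integralClosure_iff ℚ ℝ).1 hpi).isAlgebraic

end Summit.KontsevichZagierPeriods.CubeNashNormalFormNegative
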